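import Summits.KontsevichZagierPeriods.KontsevichZagierPeriods.Theorems.SoloInformedToricRational
import Summits.KontsevichZagierPeriods.KontsevichZagierPeriods.Theorems.SoloInformedToricZetaDenominators
import HarnessLib

/-!
# The cube-nondegenerate sector is multiplicatively closed

Solo programme `solo-KontsevichZagierPeriods-informed`, session s104.

Initial forms are multiplicative: `in_w(Q₁ Q₂) = in_w(Q₁) · in_w(Q₂)` (`soloInformed_initForm_mul`;
`ℚ[x]` is a domain and the `w`-degree is additive, so the least `w`-degree of a product is the sum
of the least `w`-degrees and the lowest parts multiply).  Consequently cube-nondegeneracy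
(`SoloInformedCubeNondegenerate`) is preserved under products, powers and non-zero constants
(`soloInformed_cubeNondegenerate_mul/_prod/_pow/_C`), and THEOREM ND for all numerators
(`soloInformed_presentable_of_nondegenerate_rational`) applies to every
`[[0,1]ⁿ, P/∏ᵢ Qᵢ]` whose denominator is a product of cube-nondegenerate factors
(`soloInformed_presentable_of_nondegenerate_factors`) — e.g. products of the ζ(n)-denominators
`1 − ∏ⱼ(1 − xⱼ)` and positive-coefficient polynomials.

References: A. G. Kouchnirenko, Invent. Math. 32 (1976) §1; J. Ayoub, EMS Newsl. 91 (2014) §2.2.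
-/

noncomputable section

open scoped BigOperators
open MeasureTheory Set
open Literature.NumberTheory.Transcendental Literature.NumberTheory.Transcendental.KZ

namespace Summit.KontsevichZagierPeriods.KontsevichZagierPeriods.Theorems

variable {n : ℕ}

/-! ### Coefficients of initial forms -/

/-- The `w`-degree is additive. [this work] -/
theorem soloInformed_wdeg_add (w : Fin n → ℕ) (a b : Fin n →₀ ℕ) :
    soloInformedWDeg w (a + b) = soloInformedWDeg w a + soloInformedWDeg w b := by
  simp only [soloInformedWDeg, Finsupp.add_apply, mul_add, Finset.sum_add_distrib]

open Classical in
/-- The coefficients of the initial form: `coeff e (in_w Q) = coeff e Q` if `e` is `w`-initial,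
`0` otherwise. [this work] -/
theorem soloInformed_coeff_initForm (w : Fin n → ℕ) (Q : MvPolynomial (Fin n) ℚ)
    (e : Fin n →₀ ℕ) :
    MvPolynomial.coeff e (soloInformedInitForm w Q) =
      if SoloInformedIsInit w Q e then MvPolynomial.coeff e Q else 0 := by
  unfold soloInformedInitForm
  rw [MvPolynomial.coeff_sum]
  by_cases h : SoloInformedIsInit w Q e
  · rw [if_pos h]
    by_cases he : e ∈ Q.support
    · rw [← Finset.add_sum_erase _ _ (Finset.mem_filter.2 ⟨he, h⟩), MvPolynomial.coeff_monomial,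
        if_pos rfl, Finset.sum_eq_zero fun b hb => by
          rw [MvPolynomial.coeff_monomial, if_neg (Finset.ne_of_mem_erase hb)], add_zero]
    · rw [MvPolynomial.notMem_support_iff.1 he]
      exact Finset.sum_eq_zero fun b hb => by
        rw [MvPolynomial.coeff_monomial, if_neg]
        rintro rfl
        exact he (Finset.mem_filter.1 hb).1
  · rw [if_neg h]
    exact Finset.sum_eq_zero fun b hb => by
      rw [MvPolynomial.coeff_monomial, if_neg]
      rintro rfl
      exact h (Finset.mem_filter.1 hb).2

/-- `in_w(0) = 0`. [this work] -/
theorem soloInformed_initForm_of_zero (w : Fin n → ℕ) :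
    soloInformedInitForm w (0 : MvPolynomial (Fin n) ℚ) = 0 := by
  unfold soloInformedInitForm
  rw [MvPolynomial.support_zero, Finset.filter_empty, Finset.sum_empty]

/-- For `Q ≠ 0` with `a₀` of least `w`-degree in `supp Q`: `a ∈ supp Q` is `w`-initial iff its
`w`-degree equals that of `a₀`. [this work] -/
theorem soloInformed_isInit_iff_wdeg_eq (w : Fin n → ℕ) (Q : MvPolynomial (Fin n) ℚ)
    {a₀ : Fin n →₀ ℕ} (ha₀ : a₀ ∈ Q.support)
    (hmin : ∀ b ∈ Q.support, soloInformedWDeg w a₀ ≤ soloInformedWDeg w b)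
    {a : Fin n →₀ ℕ} (ha : a ∈ Q.support) :
    SoloInformedIsInit w Q a ↔ soloInformedWDeg w a = soloInformedWDeg w a₀ := by
  refine ⟨fun h => le_antisymm (h a₀ ha₀) (hmin a ha), fun h => ?_⟩
  intro b hb
  rw [h]
  exact hmin b hb

/-! ### Initial forms are multiplicative -/

/-- **`in_w(Q₁ Q₂) = in_w(Q₁) · in_w(Q₂)`.**  [Kouchnirenko 1976, §1; this work] -/
theorem soloInformed_initForm_mul (w : Fin n → ℕ) (Q₁ Q₂ : MvPolynomial (Fin n) ℚ) :
    soloInformedInitForm w (Q₁ * Q₂) =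
      soloInformedInitForm w Q₁ * soloInformedInitForm w Q₂ := by
  classical
  by_cases h₁ : Q₁ = 0
  · rw [h₁, zero_mul, soloInformed_initForm_of_zero, zero_mul]
  by_cases h₂ : Q₂ = 0
  · rw [h₂, mul_zero, soloInformed_initForm_of_zero, mul_zero]
  obtain ⟨a₁, ha₁, hmin₁⟩ := Finset.exists_min_image Q₁.support (soloInformedWDeg w)
    (MvPolynomial.support_nonempty.2 h₁)
  obtain ⟨a₂, ha₂, hmin₂⟩ := Finset.exists_min_image Q₂.support (soloInformedWDeg w)
    (MvPolynomial.support_nonempty.2 h₂)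
  have hI₁ := fun a (ha : a ∈ Q₁.support) => soloInformed_isInit_iff_wdeg_eq w Q₁ ha₁ hmin₁ ha
  have hI₂ := fun a (ha : a ∈ Q₂.support) => soloInformed_isInit_iff_wdeg_eq w Q₂ ha₂ hmin₂ ha
  -- the coefficients of the product of the initial forms
  have hc : ∀ e, MvPolynomial.coeff e (soloInformedInitForm w Q₁ * soloInformedInitForm w Q₂) =
      if soloInformedWDeg w e = soloInformedWDeg w a₁ + soloInformedWDeg w a₂ then
        MvPolynomial.coeff e (Q₁ * Q₂) else 0 := by
    intro e
    rw [MvPolynomial.coeff_mul, MvPolynomial.coeff_mul]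
    split_ifs with he
    · refine Finset.sum_congr rfl fun p hp => ?_
      rw [Finset.HasAntidiagonal.mem_antidiagonal] at hp
      rw [soloInformed_coeff_initForm, soloInformed_coeff_initForm]
      by_cases hp₁ : p.1 ∈ Q₁.support
      · by_cases hp₂ : p.2 ∈ Q₂.support
        · have hsum : soloInformedWDeg w p.1 + soloInformedWDeg w p.2 =
              soloInformedWDeg w a₁ + soloInformedWDeg w a₂ := by
            rw [← soloInformed_wdeg_add, hp, he]
          have hl₁ := hmin₁ _ hp₁
          have hl₂ := hmin₂ _ hp₂
          have h1 : soloInformedWDeg w p.1 = soloInformedWDeg w a₁ := by omega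
          have h2 : soloInformedWDeg w p.2 = soloInformedWDeg w a₂ := by omega
          rw [if_pos ((hI₁ _ hp₁).2 h1), if_pos ((hI₂ _ hp₂).2 h2)]
        · rw [MvPolynomial.notMem_support_iff.1 hp₂]
          simp
      · rw [MvPolynomial.notMem_support_iff.1 hp₁]
        simp
    · refine Finset.sum_eq_zero fun p hp => ?_
      rw [Finset.HasAntidiagonal.mem_antidiagonal] at hp
      rw [soloInformed_coeff_initForm, soloInformed_coeff_initForm]
      by_cases hp₁ : p.1 ∈ Q₁.support
      · by_cases hp₂ : p.2 ∈ Q₂.support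
        · by_cases hi₁ : SoloInformedIsInit w Q₁ p.1
          · have hi₂ : ¬ SoloInformedIsInit w Q₂ p.2 := fun hi₂ => he (by
              rw [← hp, soloInformed_wdeg_add, (hI₁ _ hp₁).1 hi₁, (hI₂ _ hp₂).1 hi₂])
            rw [if_neg hi₂, mul_zero]
          · rw [if_neg hi₁, zero_mul]
        · rw [MvPolynomial.notMem_support_iff.1 hp₂]
          simp
      · rw [MvPolynomial.notMem_support_iff.1 hp₁]
        simp
  -- the product of the initial forms is non-zero: pick a witness exponent `e₀`
  have hne₁ : soloInformedInitForm w Q₁ ≠ 0 := fun h => by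
    have h' := congrArg (MvPolynomial.coeff a₁) h
    rw [soloInformed_coeff_initForm, if_pos (show SoloInformedIsInit w Q₁ a₁ from fun b hb => hmin₁ b hb),
      MvPolynomial.coeff_zero] at h'
    exact (MvPolynomial.mem_support_iff.1 ha₁) h'
  have hne₂ : soloInformedInitForm w Q₂ ≠ 0 := fun h => by
    have h' := congrArg (MvPolynomial.coeff a₂) h
    rw [soloInformed_coeff_initForm, if_pos (show SoloInformedIsInit w Q₂ a₂ from fun b hb => hmin₂ b hb),
      MvPolynomial.coeff_zero] at h'
    exact (MvPolynomial.mem_support_iff.1 ha₂) h'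
  obtain ⟨e₀, he₀⟩ := MvPolynomial.ne_zero_iff.1 (mul_ne_zero hne₁ hne₂)
  have he₀d : soloInformedWDeg w e₀ = soloInformedWDeg w a₁ + soloInformedWDeg w a₂ := by
    by_contra h
    rw [hc, if_neg h] at he₀
    exact he₀ rfl
  have he₀Q : MvPolynomial.coeff e₀ (Q₁ * Q₂) ≠ 0 := by rwa [hc, if_pos he₀d] at he₀
  -- every exponent of the product has `w`-degree at least the sum of the least degrees
  have hlow : ∀ e, MvPolynomial.coeff e (Q₁ * Q₂) ≠ 0 →
      soloInformedWDeg w a₁ + soloInformedWDeg w a₂ ≤ soloInformedWDeg w e := by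
    intro e he
    rw [MvPolynomial.coeff_mul] at he
    obtain ⟨p, hp, hpne⟩ := Finset.exists_ne_zero_of_sum_ne_zero he
    rw [Finset.HasAntidiagonal.mem_antidiagonal] at hp
    have hp₁ : p.1 ∈ Q₁.support := MvPolynomial.mem_support_iff.2 (left_ne_zero_of_mul hpne)
    have hp₂ : p.2 ∈ Q₂.support := MvPolynomial.mem_support_iff.2 (right_ne_zero_of_mul hpne)
    rw [← hp, soloInformed_wdeg_add]
    exact add_le_add (hmin₁ _ hp₁) (hmin₂ _ hp₂)
  -- compare coefficients
  ext e
  rw [soloInformed_coeff_initForm, hc]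
  by_cases he : MvPolynomial.coeff e (Q₁ * Q₂) = 0
  · rw [he]
    simp
  by_cases hd : soloInformedWDeg w e = soloInformedWDeg w a₁ + soloInformedWDeg w a₂
  · have hinit : SoloInformedIsInit w (Q₁ * Q₂) e := by
      intro b hb
      rw [hd]
      exact hlow b (MvPolynomial.mem_support_iff.1 hb)
    rw [if_pos hd, if_pos hinit]
  · have hinit : ¬ SoloInformedIsInit w (Q₁ * Q₂) e := fun hinit =>
      hd (le_antisymm ((hinit e₀ (MvPolynomial.mem_support_iff.2 he₀Q)).trans he₀d.le)
        (hlow e he))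
    rw [if_neg hd, if_neg hinit]

/-! ### Closure properties of cube-nondegeneracy -/

/-- **Products of cube-nondegenerate polynomials are cube-nondegenerate.** [this work] -/
theorem soloInformed_cubeNondegenerate_mul {Q₁ Q₂ : MvPolynomial (Fin n) ℚ}
    (h₁ : SoloInformedCubeNondegenerate Q₁) (h₂ : SoloInformedCubeNondegenerate Q₂) :
    SoloInformedCubeNondegenerate (Q₁ * Q₂) := by
  intro w y hy
  rw [soloInformed_initForm_mul, map_mul]
  exact mul_ne_zero (h₁ w y hy) (h₂ w y hy)

/-- `in_w(c) = c` for constants. [this work] -/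
theorem soloInformed_initForm_C (w : Fin n → ℕ) (c : ℚ) :
    soloInformedInitForm w (MvPolynomial.C c : MvPolynomial (Fin n) ℚ) = MvPolynomial.C c := by
  classical
  ext e
  rw [soloInformed_coeff_initForm, MvPolynomial.coeff_C]
  by_cases he : (0 : Fin n →₀ ℕ) = e
  · subst he
    have h0 : SoloInformedIsInit w (MvPolynomial.C c : MvPolynomial (Fin n) ℚ) 0 := by
      intro b _
      simp [soloInformedWDeg]
    rw [if_pos h0, if_pos rfl]
  · rw [if_neg he]
    simp

/-- Non-zero constants are cube-nondegenerate. [this work] -/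
theorem soloInformed_cubeNondegenerate_C {c : ℚ} (hc : c ≠ 0) :
    SoloInformedCubeNondegenerate (MvPolynomial.C c : MvPolynomial (Fin n) ℚ) := by
  intro w y _
  rw [soloInformed_initForm_C, MvPolynomial.aeval_C, eq_ratCast]
  exact_mod_cast hc

/-- `1` is cube-nondegenerate. [this work] -/
theorem soloInformed_cubeNondegenerate_one :
    SoloInformedCubeNondegenerate (1 : MvPolynomial (Fin n) ℚ) := by
  rw [← MvPolynomial.C_1]
  exact soloInformed_cubeNondegenerate_C one_ne_zero

/-- Finite products of cube-nondegenerate polynomials are cube-nondegenerate. [this work] -/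
theorem soloInformed_cubeNondegenerate_prod {ι : Type*} (s : Finset ι)
    (Q : ι → MvPolynomial (Fin n) ℚ) (h : ∀ i ∈ s, SoloInformedCubeNondegenerate (Q i)) :
    SoloInformedCubeNondegenerate (∏ i ∈ s, Q i) := by
  classical
  induction s using Finset.induction_on with
  | empty => simpa using (soloInformed_cubeNondegenerate_one (n := n))
  | insert a s ha ih =>
    rw [Finset.prod_insert ha]
    exact soloInformed_cubeNondegenerate_mul (h a (Finset.mem_insert_self a s))
      (ih fun i hi => h i (Finset.mem_insert_of_mem hi))

/-- Powers of cube-nondegenerate polynomials are cube-nondegenerate. [this work] -/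
theorem soloInformed_cubeNondegenerate_pow {Q : MvPolynomial (Fin n) ℚ}
    (h : SoloInformedCubeNondegenerate Q) (k : ℕ) : SoloInformedCubeNondegenerate (Q ^ k) := by
  induction k with
  | zero => simpa using (soloInformed_cubeNondegenerate_one (n := n))
  | succ k ih =>
    rw [pow_succ]
    exact soloInformed_cubeNondegenerate_mul ih h

/-! ### THEOREM ND for products of nondegenerate denominators -/

/-- **THEOREM ND for factored denominators.**  If every `Qᵢ` (`i ∈ s`) is cube-nondegenerate and
`P ∈ ℚ[x]` is arbitrary, then every `IntegralRep` on `[0,1]ⁿ` with integrand `P/∏ᵢ Qᵢ` on the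
open cube is presentable (`k = 1`). [this work] -/
theorem soloInformed_presentable_of_nondegenerate_factors {ι : Type*} (s : Finset ι)
    (Qs : ι → MvPolynomial (Fin n) ℚ) (hND : ∀ i ∈ s, SoloInformedCubeNondegenerate (Qs i))
    (P : MvPolynomial (Fin n) ℚ) (r : IntegralRep n) (hr : r.domain = soloInformedCube n)
    (hri : EqOn r.integrand
      (fun x => MvPolynomial.aeval x P / ∏ i ∈ s, MvPolynomial.aeval x (Qs i))
      (soloInformedOpenCube n)) :
    of r ∈ soloInformedPresentable :=
  soloInformed_presentable_of_nondegenerate_rational P (∏ i ∈ s, Qs i)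
    (soloInformed_cubeNondegenerate_prod s Qs hND) r hr fun x hx => by
      rw [hri hx]
      simp only [map_prod]

/-- Example: products of a positive-coefficient polynomial and a power of the ζ(n)-denominator,
`[[0,1]ⁿ, P/(Q₊ · (1 − ∏ⱼ(1 − xⱼ))ᵏ)]`, are presentable. [this work] -/
theorem soloInformed_presentable_pos_mul_zetaDenominator_pow (hn : 0 < n)
    (Qp : MvPolynomial (Fin n) ℚ) (hQ0 : Qp ≠ 0) (hQ : ∀ a ∈ Qp.support, 0 < Qp.coeff a) (k : ℕ)
    (P : MvPolynomial (Fin n) ℚ) (r : IntegralRep n) (hr : r.domain = soloInformedCube n)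
    (hri : EqOn r.integrand (fun x => MvPolynomial.aeval x P /
      (MvPolynomial.aeval x Qp * (1 - ∏ j, (1 - x j)) ^ k)) (soloInformedOpenCube n)) :
    of r ∈ soloInformedPresentable :=
  soloInformed_presentable_of_nondegenerate_rational P (Qp * soloInformedZetaDenominator n ^ k)
    (soloInformed_cubeNondegenerate_mul (soloInformed_cubeNondegenerate_of_pos Qp hQ0 hQ)
      (soloInformed_cubeNondegenerate_pow (soloInformed_cubeNondegenerate_zetaDenominator hn) k))
    r hr fun x hx => by
      rw [hri hx]
      simp only [map_mul, map_pow, soloInformed_aeval_zetaDenominator]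

end Summit.KontsevichZagierPeriods.KontsevichZagierPeriods.Theorems
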